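import Summits.FinalStateConjecture.FinalStateConjecture.Theorems.PhotonSphereChannelsBlindnessChannel
import Summits.FinalStateConjecture.FinalStateConjecture.Theorems.PhotonSphereChannelsBlindnessWaveSolution
import Summits.FinalStateConjecture.FinalStateConjecture.Theorems.PhotonSphereChannelsBlindnessPotential

/-!
# Route PhotonSphereChannels · BlindnessInsidePhotonSphere — the rest packet at scale `m`

Support file (everything proved) for item stmt-FinalStateConjecture-10049. For the spin-2
Regge–Wheeler potential `V_ℓ` on the tortoise line (`r' = 1 − 2M/r`, `r > 2M`), an edge `x_e < x_c`,
`ε > 0`, and an integer scale `m` (angular momentum `ℓ = m⁴`, packet width `3/m³`, comparison time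
`T = 4/m³`) satisfying three explicit largeness conditions in terms of `ε` and of constants of the
potential on `[x_e, x_e + 3]` and of a fixed plateau bump, `blindness_main` produces an even `C²`
solution `ψ` of `ψ_tt − ψ_xx + V_ℓ ψ = 0` with data `(A, 0)`, `A` the bump rescaled to
`[x_e, x_e + 3/m³] ⊂ (x_e, x_c)`-closure, positive initial energy `E₀`, and far-channel energies
`∫_{x > x_e + |t|} e(t) ≤ b` for `|t| ≥ T` with `2b ≤ ε E₀`. Mechanism: the packet is released at
rest where `V_ℓ ≍ ℓ²`; during the time `4/m³` needed by the light-speed edge of the channel to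
overtake its support it is described by the frozen oscillation `A(x) cos(√(V(x_e)) t)` up to an
energy error `O(m³)` (`far_energy_le`), while `E₀ ≳ ℓ² · m⁻³ = m⁵`. No definitions are
introduced.
-/

noncomputable section

open Set Filter MeasureTheory Topology Function

namespace Summit.FinalStateConjecture.FinalStateConjecture.Theorems.Blindness

/-- **The rest packet at scale `m`.** See the module docstring. -/
theorem blindness_main {M : ℝ} {r : ℝ → ℝ} (hM : 0 < M) (hr : ∀ x, 2 * M < r x)
    (hr' : ∀ x, HasDerivAt r (1 - 2 * M / r x) x) {xe xc ε : ℝ} (hxe : xe < xc) (hε : 0 < ε)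
    {B : ℝ → ℝ} (hB : ContDiff ℝ 2 B) (h0l : ∀ u, u ≤ 0 → B u = 0)
    (h0r : ∀ u, 3 ≤ u → B u = 0) (h1 : ∀ u ∈ Icc (1 : ℝ) 2, B u = 1)
    (h01 : ∀ u, 0 ≤ B u ∧ B u ≤ 1) {K₂ : ℝ} (hK₂ : 0 ≤ K₂) (hB2 : ∀ u, |iteratedDeriv 2 B u| ≤ K₂)
    {f₀ C₀ C₁ : ℝ} (hf₀ : 0 < f₀) (hC₁ : 0 ≤ C₁)
    (hlow : ∀ ℓ : ℕ, ∀ x ∈ Icc xe (xe + 3), (ℓ : ℝ) * ((ℓ : ℝ) + 1) * f₀ - C₀ ≤ (1 - 2 * M / r x) *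
        ((ℓ : ℝ) * ((ℓ : ℝ) + 1) / r x ^ 2 + (1 - ((2 : ℕ) : ℝ) ^ 2) * (2 * M) / r x ^ 3))
    (hlip : ∀ ℓ : ℕ, ∀ x ∈ Icc xe (xe + 3), ∀ y ∈ Icc xe (xe + 3),
        |(1 - 2 * M / r x) *
            ((ℓ : ℝ) * ((ℓ : ℝ) + 1) / r x ^ 2 + (1 - ((2 : ℕ) : ℝ) ^ 2) * (2 * M) / r x ^ 3)
          - (1 - 2 * M / r y) *
            ((ℓ : ℝ) * ((ℓ : ℝ) + 1) / r y ^ 2 + (1 - ((2 : ℕ) : ℝ) ^ 2) * (2 * M) / r y ^ 3)|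
          ≤ ((ℓ : ℝ) * ((ℓ : ℝ) + 1) + 1) * C₁ * |x - y|)
    {m : ℕ} (hm2 : 2 ≤ m) (hm3 : 3 / (xc - xe) < m) (hmC : 2 * C₀ / f₀ ≤ m)
    (hmε : 384 * (9 * C₁ + K₂) ^ 2 / (ε * f₀) ≤ (m : ℝ) ^ 2)
    (ℓ : ℕ) (hℓ : ℓ = m ^ 4) (V : ℝ → ℝ)
    (hV : V = fun x => (1 - 2 * M / r x) *
      ((ℓ : ℝ) * ((ℓ : ℝ) + 1) / r x ^ 2 + (1 - ((2 : ℕ) : ℝ) ^ 2) * (2 * M) / r x ^ 3)) :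
    ∃ ψ : ℝ → ℝ → ℝ, ContDiff ℝ 2 (uncurry ψ) ∧
      (∀ t x, iteratedDeriv 2 (fun τ => ψ τ x) t - iteratedDeriv 2 (ψ t) x + V x * ψ t x = 0) ∧
      (∀ x, x ≤ xe ∨ xc ≤ x → ψ 0 x = 0 ∧ deriv (fun τ => ψ τ x) 0 = 0) ∧
      (∀ t x, 0 ≤ deriv (fun τ => ψ τ x) t ^ 2 + deriv (ψ t) x ^ 2 + V x * ψ t x ^ 2) ∧
      (∀ t, Integrable fun x => deriv (fun τ => ψ τ x) t ^ 2 + deriv (ψ t) x ^ 2 + V x * ψ t x ^ 2) ∧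
      ∃ E0r bd Tb : ℝ, 0 < E0r ∧
        (∫ x, (deriv (fun τ => ψ τ x) 0 ^ 2 + deriv (ψ 0) x ^ 2 + V x * ψ 0 x ^ 2)) = E0r ∧
        0 ≤ bd ∧ 2 * bd ≤ ε * E0r ∧
        (∀ t, Tb ≤ |t| → (∫ x in Ioi (xe + |t|),
          (deriv (fun τ => ψ τ x) t ^ 2 + deriv (ψ t) x ^ 2 + V x * ψ t x ^ 2)) ≤ bd) := by
  -- scales
  have hm1 : (1 : ℝ) ≤ m := by exact_mod_cast (le_trans (by norm_num) hm2)
  have hm0 : (0 : ℝ) < m := by linarith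
  set c : ℝ := (m : ℝ) ^ 3 with hc
  have hc0 : 0 < c := by positivity
  have hcm : (m : ℝ) ≤ c := by
    rw [hc]; nlinarith [mul_le_mul hm1 hm1 zero_le_one hm0.le]
  have hc1 : 1 ≤ c := hm1.trans hcm
  have hxce : 0 < xc - xe := by linarith
  have h3c : 3 / c < xc - xe := by
    have h1 : 3 / (xc - xe) < c := lt_of_lt_of_le hm3 hcm
    rw [div_lt_iff₀ hxce] at h1; rw [div_lt_iff₀ hc0]; linarith
  have h3c' : 3 / c ≤ 3 := by rw [div_le_iff₀ hc0]; nlinarith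
  set ℓr : ℝ := (ℓ : ℝ) * ((ℓ : ℝ) + 1) with hℓr
  have hℓcast : (ℓ : ℝ) = (m : ℝ) ^ 4 := by rw [hℓ]; push_cast; ring
  have hℓr8 : (m : ℝ) ^ 8 ≤ ℓr := by
    rw [hℓr, hℓcast]; nlinarith [pow_nonneg hm0.le 4]
  have hℓr3 : ℓr + 1 ≤ 3 * (m : ℝ) ^ 8 := by
    rw [hℓr, hℓcast]
    have h4 : (1 : ℝ) ≤ (m : ℝ) ^ 4 := one_le_pow₀ hm1
    nlinarith [pow_nonneg hm0.le 4]
  have hℓrm : (m : ℝ) ≤ ℓr := by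
    refine le_trans ?_ hℓr8
    calc (m : ℝ) = (m : ℝ) ^ 1 := (pow_one _).symm
      _ ≤ (m : ℝ) ^ 8 := pow_le_pow_right₀ hm1 (by norm_num)
  have hℓr0 : 0 < ℓr := lt_of_lt_of_le hm0 hℓrm
  have hℓ2 : 2 ≤ ℓ := by
    rw [hℓ]; calc 2 ≤ 2 ^ 4 := by norm_num
      _ ≤ m ^ 4 := Nat.pow_le_pow_left hm2 4
  -- the potential
  subst hV
  have hV1 := contDiff_one_potential hM hr hr' ℓ
  have hVpos := potential_pos hM hr hℓ2
  have hVnn : ∀ x, 0 ≤ (1 - 2 * M / r x) *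
      ((ℓ : ℝ) * ((ℓ : ℝ) + 1) / r x ^ 2 + (1 - ((2 : ℕ) : ℝ) ^ 2) * (2 * M) / r x ^ 3) :=
    fun x => (hVpos x).le
  have hVb := abs_potential_le hM hr ℓ
  set Vf : ℝ → ℝ := fun x => (1 - 2 * M / r x) *
      ((ℓ : ℝ) * ((ℓ : ℝ) + 1) / r x ^ 2 + (1 - ((2 : ℕ) : ℝ) ^ 2) * (2 * M) / r x ^ 3) with hVf
  -- the datum
  obtain ⟨hA2, hA0l, hA0r, hA1, hA01, hA''⟩ := scaled_profile hB h0l h0r h1 h01 hc0 xe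
  set A : ℝ → ℝ := fun x => B (c * (x - xe)) with hA
  have hAoff : ∀ x, x ∉ Icc xe (xe + 3 / c) → A x = 0 := by
    intro x hx
    by_cases h : x ≤ xe
    · exact hA0l x h
    · exact hA0r x (le_of_not_ge fun h' => hx ⟨le_of_not_ge h, h'⟩)
  have hAoff' : ∀ x, (x < xe ∨ xe + 3 / c < x) → A x = 0 :=
    fun x hx => hAoff x fun h => by rcases hx with hx | hx <;> linarith [h.1, h.2]
  -- the solution
  obtain ⟨ψ, hψ2, hsol, hψ0, hψ1, heven, hsupp⟩ :=
    exists_even_solution (α := xe) (β := xe + 3 / c) hV1 hVb hA2 hAoff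
  -- energy densities: non-negativity and integrability
  have he0 : ∀ t x, 0 ≤ deriv (fun τ => ψ τ x) t ^ 2 + deriv (ψ t) x ^ 2 + Vf x * ψ t x ^ 2 :=
    fun t x => by have := mul_nonneg (hVnn x) (sq_nonneg (ψ t x)); positivity
  have he_eq : ∀ s, (fun x => deriv (fun τ => ψ τ x) s ^ 2 + deriv (ψ s) x ^ 2 + Vf x * ψ s x ^ 2)
      = fun x => fderiv ℝ (uncurry ψ) (s, x) (1, 0) ^ 2 + fderiv ℝ (uncurry ψ) (s, x) (0, 1) ^ 2
        + Vf x * ψ s x ^ 2 := fun s => funext fun x => energyDensity_eq hψ2 s x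
  have hInt : ∀ s, Integrable fun x =>
      deriv (fun τ => ψ τ x) s ^ 2 + deriv (ψ s) x ^ 2 + Vf x * ψ s x ^ 2 := by
    intro s
    rw [he_eq s]
    have h1 := (continuous_fderiv_apply hψ2 (1, 0)).comp (Continuous.prodMk_right s)
    have h2 := (continuous_fderiv_apply hψ2 (0, 1)).comp (Continuous.prodMk_right s)
    have h3 := hψ2.continuous.comp (Continuous.prodMk_right s)
    exact integrable_of_fields (s := s) hψ2 hsupp
      (((h1.pow 2).add (h2.pow 2)).add (hV1.continuous.mul (h3.pow 2)))
      (fun x h1 h2 h3 _ _ => by simp [h1, h2, h3])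
  -- the residual bound `N`
  set N : ℝ := 3 * (ℓr + 1) * C₁ / c + c ^ 2 * K₂ with hN
  have hN0 : 0 ≤ N := by positivity
  set ω₀ : ℝ := Real.sqrt (Vf xe) with hω₀
  have hω₀2 : ω₀ ^ 2 = Vf xe := Real.sq_sqrt (hVnn xe)
  have hres : ∀ t x, |((Vf x - ω₀ ^ 2) * A x - iteratedDeriv 2 A x) * Real.cos (ω₀ * t)| ≤ N := by
    intro t x
    rw [abs_mul]
    refine le_trans (mul_le_of_le_one_right (abs_nonneg _) (Real.abs_cos_le_one _)) ?_
    by_cases hx : x ∈ Icc xe (xe + 3 / c)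
    · have hxK : x ∈ Icc xe (xe + 3) := ⟨hx.1, hx.2.trans (by linarith)⟩
      have hxeK : xe ∈ Icc xe (xe + 3) := ⟨le_rfl, by linarith⟩
      have hVd : |Vf x - Vf xe| ≤ (ℓr + 1) * C₁ * (3 / c) := by
        refine (hlip ℓ x hxK xe hxeK).trans ?_
        rw [abs_of_nonneg (by linarith [hx.1])]
        exact mul_le_mul_of_nonneg_left (by linarith [hx.2]) (by positivity)
      have hAx : |A x| ≤ 1 := by
        rw [abs_of_nonneg (hA01 x).1]; exact (hA01 x).2
      have hA''x : |iteratedDeriv 2 A x| ≤ c ^ 2 * K₂ := by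
        rw [hA'' x, abs_mul, abs_of_nonneg (by positivity)]
        exact mul_le_mul_of_nonneg_left (hB2 _) (by positivity)
      rw [hω₀2]
      calc |(Vf x - Vf xe) * A x - iteratedDeriv 2 A x|
          ≤ |(Vf x - Vf xe) * A x| + |iteratedDeriv 2 A x| := abs_sub _ _
        _ = |Vf x - Vf xe| * |A x| + |iteratedDeriv 2 A x| := by rw [abs_mul]
        _ ≤ (ℓr + 1) * C₁ * (3 / c) * 1 + c ^ 2 * K₂ :=
            add_le_add (mul_le_mul hVd hAx (abs_nonneg _) (by positivity)) hA''x
        _ = N := by rw [hN]; ring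
    · have hx' : x < xe ∨ xe + 3 / c < x := by
        by_contra h
        exact hx ⟨le_of_not_gt fun h' => h (Or.inl h'), le_of_not_gt fun h' => h (Or.inr h')⟩
      have hAev : A =ᶠ[𝓝 x] fun _ => (0 : ℝ) := by
        rcases hx' with hx' | hx'
        · filter_upwards [Iio_mem_nhds hx'] with y hy using hAoff' y (Or.inl hy)
        · filter_upwards [Ioi_mem_nhds hx'] with y hy using hAoff' y (Or.inr hy)
      rw [hAoff x hx, iteratedDeriv_two_eq_zero_of_eventuallyEq hAev]
      simp [hN0]
  -- the far-channel bound
  have hT : xe + 3 / c - xe < 4 / c := by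
    rw [add_sub_cancel_left, div_lt_div_iff_of_pos_right hc0]; norm_num
  have hfar := far_energy_le (ω₀ := ω₀) hV1 hVnn hψ2 hsol heven hsupp hψ0 hψ1 hA2 hAoff'
    (by linarith [div_pos (by norm_num : (0:ℝ) < 3) hc0]) hT hres
  -- the initial energy
  have hψ0f : ψ 0 = A := funext hψ0
  have hE0low : ℓr * f₀ / 2 * (1 / c)
      ≤ ∫ x, (deriv (fun τ => ψ τ x) 0 ^ 2 + deriv (ψ 0) x ^ 2 + Vf x * ψ 0 x ^ 2) := by
    have hVA : Integrable fun x => Vf x * A x ^ 2 :=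
      integrable_of_exterior (a := xe) (b := xe + 3 / c) (hV1.continuous.mul (hA2.continuous.pow 2))
        (fun x hx => by simp [hAoff' x hx])
    have hstep1 : (∫ x, Vf x * A x ^ 2)
        ≤ ∫ x, (deriv (fun τ => ψ τ x) 0 ^ 2 + deriv (ψ 0) x ^ 2 + Vf x * ψ 0 x ^ 2) := by
      refine integral_mono hVA (hInt 0) fun x => ?_
      rw [hψ1 x, hψ0f]
      have h2 : (0 : ℝ) ≤ (0 : ℝ) ^ 2 + deriv A x ^ 2 := by positivity
      linarith only [h2]
    have hstep2 : (∫ x in Icc (xe + 1 / c) (xe + 2 / c), Vf x * A x ^ 2) ≤ ∫ x, Vf x * A x ^ 2 :=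
      setIntegral_le_integral hVA (Eventually.of_forall fun x =>
        mul_nonneg (hVnn x) (sq_nonneg _))
    have hstep3 : ℓr * f₀ / 2 * (1 / c) ≤ ∫ x in Icc (xe + 1 / c) (xe + 2 / c), Vf x * A x ^ 2 := by
      have hconst : ∀ x ∈ Icc (xe + 1 / c) (xe + 2 / c), ℓr * f₀ / 2 ≤ Vf x * A x ^ 2 := by
        intro x hx
        have hxK : x ∈ Icc xe (xe + 3) := by
          constructor
          · linarith only [hx.1, div_pos one_pos hc0]
          · have : 2 / c ≤ 3 := by rw [div_le_iff₀ hc0]; linarith only [hc1]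
            linarith only [hx.2, this]
        rw [show A x = 1 from hA1 x hx, one_pow, mul_one]
        have h := hlow ℓ x hxK
        have hℓf : 2 * C₀ ≤ ℓr * f₀ := by
          have h1 : 2 * C₀ ≤ (m : ℝ) * f₀ := by rwa [div_le_iff₀ hf₀] at hmC
          exact h1.trans (mul_le_mul_of_nonneg_right hℓrm hf₀.le)
        refine le_trans ?_ h
        show ℓr * f₀ / 2 ≤ ℓr * f₀ - C₀
        linarith only [hℓf]
      have h := setIntegral_ge_of_const_le (μ := volume) (s := Icc (xe + 1 / c) (xe + 2 / c))
        measurableSet_Icc (by rw [Real.volume_Icc]; exact ENNReal.ofReal_ne_top) hconst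
        (hVA.integrableOn)
      have h1c : xe + 1 / c ≤ xe + 2 / c := by
        have : 1 / c ≤ 2 / c := div_le_div_of_nonneg_right (by norm_num) hc0.le
        linarith
      rw [Real.volume_real_Icc_of_le h1c, show xe + 2 / c - (xe + 1 / c) = 1 / c by ring,
        smul_eq_mul, mul_comm] at h
      exact h
    exact hstep3.trans (hstep2.trans hstep1)
  -- bookkeeping of the constants
  set E0r : ℝ := ∫ x, (deriv (fun τ => ψ τ x) 0 ^ 2 + deriv (ψ 0) x ^ 2 + Vf x * ψ 0 x ^ 2)
    with hE0r
  set bd : ℝ := (Real.exp 1 - 1) * (4 / c) ^ 2 * ((xe + 3 / c - xe) * N ^ 2) with hbd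
  have hE0pos : 0 < E0r := lt_of_lt_of_le (by positivity) hE0low
  have hexp2 : Real.exp 1 - 1 ≤ 2 := by
    have := Real.exp_one_lt_d9; norm_num at this; linarith
  have hbd0 : 0 ≤ bd := by
    rw [hbd, add_sub_cancel_left]
    have h1 : 0 ≤ Real.exp 1 - 1 := by linarith [Real.add_one_le_exp (1:ℝ)]
    positivity
  -- `N ≤ D m⁶`, `D = 9 C₁ + K₂`
  have hND : N ≤ (9 * C₁ + K₂) * (m : ℝ) ^ 6 := by
    have ha : 3 * (ℓr + 1) * C₁ ≤ 9 * (m : ℝ) ^ 8 * C₁ := by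
      have := mul_le_mul_of_nonneg_right hℓr3 hC₁
      linarith
    have hb : 3 * (ℓr + 1) * C₁ / c ≤ 9 * (m : ℝ) ^ 8 * C₁ / c :=
      div_le_div_of_nonneg_right ha hc0.le
    have hc' : 9 * (m : ℝ) ^ 8 * C₁ / c = 9 * C₁ * (m : ℝ) ^ 5 := by
      rw [div_eq_iff hc0.ne', hc]; ring
    have hd : 9 * C₁ * (m : ℝ) ^ 5 ≤ 9 * C₁ * (m : ℝ) ^ 6 :=
      mul_le_mul_of_nonneg_left (pow_le_pow_right₀ hm1 (by norm_num)) (by positivity)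
    have he : c ^ 2 * K₂ = K₂ * (m : ℝ) ^ 6 := by rw [hc]; ring
    rw [hN, he]
    linarith
  have hkey : 2 * bd ≤ ε * E0r := by
    have hD : 0 ≤ 9 * C₁ + K₂ := by positivity
    -- `2 bd ≤ 192 N² / c³ ≤ 192 D² m³`
    have h2bd : 2 * bd ≤ 192 * ((9 * C₁ + K₂) ^ 2 * (m : ℝ) ^ 3) := by
      rw [hbd, add_sub_cancel_left]
      have hN2 : N ^ 2 ≤ (9 * C₁ + K₂) ^ 2 * (m : ℝ) ^ 12 := by
        calc N ^ 2 ≤ ((9 * C₁ + K₂) * (m : ℝ) ^ 6) ^ 2 := pow_le_pow_left₀ hN0 hND 2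
          _ = (9 * C₁ + K₂) ^ 2 * (m : ℝ) ^ 12 := by ring
      have he := hexp2
      have h1 : 0 ≤ Real.exp 1 - 1 := by linarith [Real.add_one_le_exp (1:ℝ)]
      have hcc : c ^ 3 = (m : ℝ) ^ 9 := by rw [hc]; ring
      calc 2 * ((Real.exp 1 - 1) * (4 / c) ^ 2 * (3 / c * N ^ 2))
          = (Real.exp 1 - 1) * (96 * N ^ 2 / c ^ 3) := by field_simp; ring
        _ ≤ 2 * (96 * N ^ 2 / c ^ 3) := mul_le_mul_of_nonneg_right he (by positivity)
        _ ≤ 2 * (96 * ((9 * C₁ + K₂) ^ 2 * (m : ℝ) ^ 12) / c ^ 3) := by gcongr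
        _ = 192 * ((9 * C₁ + K₂) ^ 2 * (m : ℝ) ^ 3) := by
            rw [hcc]; field_simp; ring
    -- `ε E0r ≥ ε f₀ m⁵ / 2`
    have hE0' : ε * (f₀ * (m : ℝ) ^ 5 / 2) ≤ ε * E0r := by
      refine mul_le_mul_of_nonneg_left (le_trans ?_ hE0low) hε.le
      have hre : ℓr * f₀ / 2 * (1 / c) = ℓr * f₀ / (2 * c) := by ring
      rw [hre, le_div_iff₀ (by positivity), hc]
      calc f₀ * (m : ℝ) ^ 5 / 2 * (2 * (m : ℝ) ^ 3) = (m : ℝ) ^ 8 * f₀ := by ring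
        _ ≤ ℓr * f₀ := mul_le_mul_of_nonneg_right hℓr8 hf₀.le
    -- the largeness condition `384 D² ≤ ε f₀ m²`
    have hm' : 384 * (9 * C₁ + K₂) ^ 2 ≤ ε * f₀ * (m : ℝ) ^ 2 := by
      have h := hmε
      rw [div_le_iff₀ (mul_pos hε hf₀)] at h
      linarith only [h]
    have h3 := mul_le_mul_of_nonneg_right hm' (pow_nonneg hm0.le 3)
    have hre : ε * (f₀ * (m : ℝ) ^ 5 / 2) = ε * f₀ * (m : ℝ) ^ 2 * (m : ℝ) ^ 3 / 2 := by ring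
    calc 2 * bd ≤ 192 * ((9 * C₁ + K₂) ^ 2 * (m : ℝ) ^ 3) := h2bd
      _ ≤ ε * (f₀ * (m : ℝ) ^ 5 / 2) := by rw [hre]; linarith
      _ ≤ ε * E0r := hE0'
  -- assemble
  refine ⟨ψ, hψ2, hsol, fun x hx => ⟨?_, hψ1 x⟩, he0, hInt, E0r, bd, 4 / c, hE0pos, rfl, hbd0, hkey,
    fun t ht => hfar t ht⟩
  rw [hψ0 x]
  rcases hx with hx | hx
  · exact hA0l x hx
  · exact hA0r x (by linarith)

end Summit.FinalStateConjecture.FinalStateConjecture.Theorems.Blindness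

end
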